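import Mathlib
import Summits.Ventures.PercRepro2.TypedFibreSurgery

/-!
# The b-transfer rule of the typed equality locus (blind cell PercRepro2, mine-2 g37, 2026-08-28;
`proofs/MINE2-FIBRE.md` §1, row M2-76)

Fix a spectator copy with forced-open configuration `z` (open exactly on the edges open in both other
copies) and split set `S` (the edges open in exactly one of the two other copies); the two other copies
are the complementary pairs `(y, flipOn S y)` with `y = z` off `S`, and the typed count of `K₃`
restricted to the spectator is the complementary-pair count `pinnedCount S z` of a two-copy kernel
(`TypedSpectator.lean`).  The pieces of the symmetrised form are the split covariances
`1_Q(y) 1_Q(w) (X(w) − X(y)) (σ_b(w) − σ_b(y))` with `X` a function of the clusters of the marks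
`o, a₁, a₂, a₃` (`X = σ_o − σ₃ u_o`, resp. `X = σ₃`).

**Theorem (`pinnedCount_transfer_eq_zero`).** If no forced-open edge meets `b` and every split edge at
`b` leads to a vertex joined to a root by forced-open edges (`TransferData`), then the complementary-pair
count of every such covariance vanishes.  Proof: moving all of `b`'s split edges to the other copy
(`flipOn (splitAt S)`) is a fixed-point-free involution of the pairs; on a pair with `Q` in both copies
`b` only ever joins one root cluster, so it is redundant for the connectivity of the other vertices
(b-surgery, `TypedFibreSurgery.lean`), the gates and `X` are unchanged and the two side signs of `b` are
exchanged (`transfer`, `covB_flip_of_Q`); the terms cancel in pairs (`Finset.sum_involution`).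

Own code; standard axioms.
-/

namespace Summit.Ventures.PercRepro2

open UnionCluster

namespace CovForm

namespace FibreTransfer

/-! ## The involution and the theorem -/

section Main

open Classical

variable {V : Type*} {E : Type*} [Fintype E] [DecidableEq E] [DecidableEq V] {R : Type*} [Field R]
variable (ends : E → Sym2 V) (a₁ a₂ b : V)

/-- The split edges at `b`. -/
def splitAt (S : Finset E) : Finset E := S.filter (fun e => b ∈ ends e)

omit [Fintype E] [DecidableEq E] in
/-- The split edges at `b` are split edges. -/
lemma splitAt_subset (S : Finset E) : splitAt ends b S ⊆ S := Finset.filter_subset _ _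

omit [Fintype E] [DecidableEq E] in
/-- Membership in the split edges at `b`. -/
lemma mem_splitAt {S : Finset E} {e : E} : e ∈ splitAt ends b S ↔ e ∈ S ∧ b ∈ ends e := by
  simp [splitAt]

omit [Fintype E] in
/-- `flipOn G` is an involution. -/
lemma flipOn_self (G : Finset E) (y : Config E) : flipOn G (flipOn G y) = y := by
  funext e
  by_cases h : e ∈ G <;> simp [flipOn, h]

omit [Fintype E] in
/-- Flipping on the split edges at `b` commutes with flipping on `S`. -/
lemma flipOn_splitAt_comm (S : Finset E) (y : Config E) :
    flipOn S (flipOn (splitAt ends b S) y) = flipOn (splitAt ends b S) (flipOn S y) := by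
  funext e
  by_cases hS : e ∈ S <;> by_cases hb : e ∈ splitAt ends b S <;> simp [flipOn, hS, hb]

omit [Fintype E] in
/-- Off the edges at `b`, `flipOn (splitAt S)` changes nothing. -/
lemma flipOn_splitAt_of_notMem (S : Finset E) (y : Config E) {e : E} (h : b ∉ ends e) :
    flipOn (splitAt ends b S) y e = y e := by
  have : e ∉ splitAt ends b S := fun he => h ((mem_splitAt ends b).1 he).2
  exact flipOn_of_notMem _ _ this

omit [Fintype E] in
/-- At the edges at `b`, `flipOn (splitAt S) y` is `flipOn S y` (for `y` closed at `b` off `S`). -/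
lemma flipOn_splitAt_of_mem (S : Finset E) (z y : Config E) (hy : ∀ e, e ∉ S → y e = z e)
    (hbz : ∀ e, b ∈ ends e → z e = false) {e : E} (h : b ∈ ends e) :
    flipOn (splitAt ends b S) y e = flipOn S y e := by
  by_cases hS : e ∈ S
  · have : e ∈ splitAt ends b S := (mem_splitAt ends b).2 ⟨hS, h⟩
    rw [flipOn_of_mem _ _ this, flipOn_of_mem _ _ hS]
  · have : e ∉ splitAt ends b S := fun he => hS ((mem_splitAt ends b).1 he).1
    rw [flipOn_of_notMem _ _ this, flipOn_of_notMem _ _ hS, hy e hS, hbz e h]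

/-- The data of a fibre: the forced-open configuration `z` closed on the split set `S` and at `b`,
and every split edge at `b` leading to a root-attached vertex. -/
structure TransferData (S : Finset E) (z : Config E) : Prop where
  zS : ∀ e ∈ S, z e = false
  zb : ∀ e, b ∈ ends e → z e = false
  att : ∀ e ∈ S, ∀ u, ends e = s(b, u) → Conn ends z u a₁ ∨ Conn ends z u a₂

/-- The split covariance of a `b`-blind `X` against the side of `b`, on a pair of copies. -/
noncomputable def covB (X : Config E → R) (y w : Config E) : R :=
  iQ ends a₁ a₂ y * iQ ends a₁ a₂ w * (X w - X y) * (sigma ends a₁ a₂ b w - sigma ends a₁ a₂ b y)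

variable {ends a₁ a₂ b}

omit [Fintype E] in
/-- The forced-open configuration lies below every copy of the fibre with the edges at `b` closed. -/
lemma TransferData.le_closeAt {S : Finset E} {z : Config E} (hd : TransferData ends a₁ a₂ b S z)
    (ω : Config E) (hω : ∀ e, e ∉ S → ω e = z e) : z ≤ closeAt ends b ω := by
  intro e
  by_cases hb : b ∈ ends e
  · rw [closeAt_of_mem ends hb, hd.zb e hb]
  · rw [closeAt_of_notMem ends hb]
    by_cases hS : e ∈ S
    · rw [hd.zS e hS]; exact Bool.false_le _
    · rw [hω e hS]

omit [Fintype E] in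
/-- The forced-open configuration lies below every copy of the fibre. -/
lemma TransferData.le {S : Finset E} {z : Config E} (hd : TransferData ends a₁ a₂ b S z)
    (ω : Config E) (hω : ∀ e, e ∉ S → ω e = z e) : z ≤ ω :=
  (TransferData.le_closeAt hd ω hω).trans (closeAt_le ends b ω)

omit [Fintype E] [DecidableEq V] in
/-- In a copy of the fibre every open edge at `b` is a split edge, hence leads to a root-attached vertex. -/
lemma TransferData.hopen {S : Finset E} {z : Config E} (hd : TransferData ends a₁ a₂ b S z)
    (ω : Config E) (hω : ∀ e, e ∉ S → ω e = z e) :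
    ∀ e, ω e = true → ∀ u, ends e = s(b, u) → Conn ends z u a₁ ∨ Conn ends z u a₂ := by
  intro e he u hends
  by_cases hS : e ∈ S
  · exact hd.att e hS u hends
  · exfalso
    have hb : b ∈ ends e := by rw [hends]; exact Sym2.mem_mk_left b u
    rw [hω e hS, hd.zb e hb] at he
    exact Bool.false_ne_true he

omit [Fintype E] in
/-- A configuration of the fibre agrees with `z` off `S`; so does its `b`-flip. -/
lemma agree_flip_splitAt {S : Finset E} {z : Config E} (y : Config E)
    (hy : ∀ e, e ∉ S → y e = z e) : ∀ e, e ∉ S → flipOn (splitAt ends b S) y e = z e := by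
  intro e he
  rw [flipOn_of_notMem _ _ (fun h => he (splitAt_subset ends b S h))]
  exact hy e he

omit [Fintype E] in
/-- The complementary copy agrees with `z` off `S`. -/
lemma agree_flip {S : Finset E} {z : Config E} (y : Config E)
    (hy : ∀ e, e ∉ S → y e = z e) : ∀ e, e ∉ S → flipOn S y e = z e := by
  intro e he
  rw [flipOn_of_notMem _ _ he]
  exact hy e he

omit [Fintype E] in
/-- **The transfer step**: on a pair `(y, w = flipOn S y)` of the fibre with `Q` in both copies, the
`b`-flip `y' = flipOn (splitAt S) y` has the connectivity of `y` off `b` and the side of `b` of `w`. -/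
lemma transfer {S : Finset E} {z : Config E} (hd : TransferData ends a₁ a₂ b S z) (h1 : a₁ ≠ b)
    (h2 : a₂ ≠ b) (y : Config E) (hy : ∀ e, e ∉ S → y e = z e)
    (hQy : ¬ Conn ends y a₂ a₁) (hQw : ¬ Conn ends (flipOn S y) a₂ a₁) :
    (∀ u v, u ≠ b → v ≠ b →
      (Conn ends (flipOn (splitAt ends b S) y) u v ↔ Conn ends y u v)) ∧
    (Conn ends (flipOn (splitAt ends b S) y) b a₁ ↔ Conn ends (flipOn S y) b a₁) ∧
    (Conn ends (flipOn (splitAt ends b S) y) b a₂ ↔ Conn ends (flipOn S y) b a₂) := by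
  have hw_agree : ∀ e, e ∉ S → flipOn S y e = z e := agree_flip y hy
  have hy'_agree : ∀ e, e ∉ S → flipOn (splitAt ends b S) y e = z e := agree_flip_splitAt y hy
  -- `y'` and `w` have the same edges at `b`; `y'` and `y` the same edges off `b`
  have hy'w : ∀ e, b ∈ ends e → flipOn (splitAt ends b S) y e = flipOn S y e := fun e he =>
    flipOn_splitAt_of_mem ends b S z y hy hd.zb he
  have hy'y : ∀ e, b ∉ ends e → flipOn (splitAt ends b S) y e = y e := fun e he =>
    flipOn_splitAt_of_notMem ends b S y he
  -- one side in `y` and in `w`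
  obtain ⟨ry, Hy⟩ := one_side ends a₁ a₂ b z y (TransferData.le hd y hy) (TransferData.hopen hd y hy) hQy
  obtain ⟨rw', Hw⟩ := one_side ends a₁ a₂ b z (flipOn S y) (TransferData.le hd _ hw_agree)
    (TransferData.hopen hd _ hw_agree) hQw
  have hclose : closeAt ends b (flipOn (splitAt ends b S) y) = closeAt ends b y :=
    closeAt_eq_of_agree ends hy'y
  -- the surgery hypotheses
  have Hy₀ : ∀ e, y e = true → ∀ u, ends e = s(b, u) → Conn ends (closeAt ends b y) u ry :=
    fun e he u hends => conn_mono (TransferData.le_closeAt hd y hy) (Hy e he u hends)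
  have Hy'₀ : ∀ e, flipOn (splitAt ends b S) y e = true → ∀ u, ends e = s(b, u) →
      Conn ends (closeAt ends b (flipOn (splitAt ends b S) y)) u rw' := by
    intro e he u hends
    have hb : b ∈ ends e := by rw [hends]; exact Sym2.mem_mk_left b u
    rw [hy'w e hb] at he
    exact conn_mono (TransferData.le_closeAt hd _ hy'_agree) (Hw e he u hends)
  have hc : ∀ u v, u ≠ b → v ≠ b →
      (Conn ends (flipOn (splitAt ends b S) y) u v ↔ Conn ends y u v) := by
    intro u v hu hv
    rw [conn_iff_closeAt ends _ Hy'₀ hu hv, conn_iff_closeAt ends y Hy₀ hu hv, hclose]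
  refine ⟨hc, ?_, ?_⟩
  · have hQy' : ¬ Conn ends (flipOn (splitAt ends b S) y) a₂ a₁ := by
      rw [hc a₂ a₁ h2 h1]; exact hQy
    rw [conn_b_iff ends a₁ a₂ b z _ (TransferData.le_closeAt hd _ hy'_agree) (TransferData.hopen hd _ hy'_agree) hQy'
      (Or.inl rfl) h1, conn_b_iff ends a₁ a₂ b z _ (TransferData.le_closeAt hd _ hw_agree)
      (TransferData.hopen hd _ hw_agree) hQw (Or.inl rfl) h1]
    constructor
    · rintro ⟨e, he, u, hends, hcu⟩
      have hb : b ∈ ends e := by rw [hends]; exact Sym2.mem_mk_left b u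
      exact ⟨e, by rw [← hy'w e hb]; exact he, u, hends, hcu⟩
    · rintro ⟨e, he, u, hends, hcu⟩
      have hb : b ∈ ends e := by rw [hends]; exact Sym2.mem_mk_left b u
      exact ⟨e, by rw [hy'w e hb]; exact he, u, hends, hcu⟩
  · have hQy' : ¬ Conn ends (flipOn (splitAt ends b S) y) a₂ a₁ := by
      rw [hc a₂ a₁ h2 h1]; exact hQy
    rw [conn_b_iff ends a₁ a₂ b z _ (TransferData.le_closeAt hd _ hy'_agree) (TransferData.hopen hd _ hy'_agree) hQy'
      (Or.inr rfl) h2, conn_b_iff ends a₁ a₂ b z _ (TransferData.le_closeAt hd _ hw_agree)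
      (TransferData.hopen hd _ hw_agree) hQw (Or.inr rfl) h2]
    constructor
    · rintro ⟨e, he, u, hends, hcu⟩
      have hb : b ∈ ends e := by rw [hends]; exact Sym2.mem_mk_left b u
      exact ⟨e, by rw [← hy'w e hb]; exact he, u, hends, hcu⟩
    · rintro ⟨e, he, u, hends, hcu⟩
      have hb : b ∈ ends e := by rw [hends]; exact Sym2.mem_mk_left b u
      exact ⟨e, by rw [hy'w e hb]; exact he, u, hends, hcu⟩

omit [Fintype E] in
/-- With `Q` in both copies, the `b`-flip negates the covariance term. -/
lemma covB_flip_of_Q {S : Finset E} {z : Config E} (hd : TransferData ends a₁ a₂ b S z)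
    (h1 : a₁ ≠ b) (h2 : a₂ ≠ b) {X : Config E → R} (hX : BBlind ends b X) (y : Config E)
    (hy : ∀ e, e ∉ S → y e = z e) (hQy : ¬ Conn ends y a₂ a₁)
    (hQw : ¬ Conn ends (flipOn S y) a₂ a₁) :
    covB ends a₁ a₂ b X (flipOn (splitAt ends b S) y) (flipOn (splitAt ends b S) (flipOn S y)) =
      - covB ends a₁ a₂ b X y (flipOn S y) := by
  obtain ⟨hc, hb1, hb2⟩ := transfer hd h1 h2 y hy hQy hQw
  have hw_agree : ∀ e, e ∉ S → flipOn S y e = z e := agree_flip y hy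
  have hyy : flipOn S (flipOn S y) = y := flipOn_self S y
  obtain ⟨hc', hb1', hb2'⟩ := transfer hd h1 h2 (flipOn S y) hw_agree hQw (by rw [hyy]; exact hQy)
  rw [hyy] at hb1' hb2'
  have hQy' : ¬ Conn ends (flipOn (splitAt ends b S) y) a₂ a₁ := by rw [hc a₂ a₁ h2 h1]; exact hQy
  have hQw' : ¬ Conn ends (flipOn (splitAt ends b S) (flipOn S y)) a₂ a₁ := by
    rw [hc' a₂ a₁ h2 h1]; exact hQw
  have hXy : X (flipOn (splitAt ends b S) y) = X y := hX _ _ hc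
  have hXw : X (flipOn (splitAt ends b S) (flipOn S y)) = X (flipOn S y) := hX _ _ hc'
  have e1 : Conn ends (flipOn (splitAt ends b S) y) a₁ b ↔ Conn ends (flipOn S y) a₁ b :=
    ⟨fun h => conn_symm (hb1.1 (conn_symm h)), fun h => conn_symm (hb1.2 (conn_symm h))⟩
  have e2 : Conn ends (flipOn (splitAt ends b S) y) a₂ b ↔ Conn ends (flipOn S y) a₂ b :=
    ⟨fun h => conn_symm (hb2.1 (conn_symm h)), fun h => conn_symm (hb2.2 (conn_symm h))⟩
  have e1' : Conn ends (flipOn (splitAt ends b S) (flipOn S y)) a₁ b ↔ Conn ends y a₁ b :=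
    ⟨fun h => conn_symm (hb1'.1 (conn_symm h)), fun h => conn_symm (hb1'.2 (conn_symm h))⟩
  have e2' : Conn ends (flipOn (splitAt ends b S) (flipOn S y)) a₂ b ↔ Conn ends y a₂ b :=
    ⟨fun h => conn_symm (hb2'.1 (conn_symm h)), fun h => conn_symm (hb2'.2 (conn_symm h))⟩
  unfold covB
  rw [iQ_eq_ite, iQ_eq_ite, iQ_eq_ite, iQ_eq_ite, sigma_eq_ite, sigma_eq_ite, sigma_eq_ite,
    sigma_eq_ite, hXy, hXw, if_neg hQy, if_neg hQw, if_neg hQy', if_neg hQw']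
  simp only [e1, e2, e1', e2']
  ring

omit [Fintype E] in
/-- Without `Q` in both copies the term vanishes, before and after the `b`-flip. -/
lemma covB_eq_zero_of_not_Q {S : Finset E} {z : Config E} (hd : TransferData ends a₁ a₂ b S z)
    (h1 : a₁ ≠ b) (h2 : a₂ ≠ b) (X : Config E → R) (y : Config E)
    (hy : ∀ e, e ∉ S → y e = z e) (hQ : ¬ (¬ Conn ends y a₂ a₁ ∧ ¬ Conn ends (flipOn S y) a₂ a₁)) :
    covB ends a₁ a₂ b X y (flipOn S y) = 0 ∧
      covB ends a₁ a₂ b X (flipOn (splitAt ends b S) y)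
        (flipOn (splitAt ends b S) (flipOn S y)) = 0 := by
  have hor : Conn ends y a₂ a₁ ∨ Conn ends (flipOn S y) a₂ a₁ := by
    by_contra h
    exact hQ ⟨fun ha => h (Or.inl ha), fun hb => h (Or.inr hb)⟩
  constructor
  · unfold covB
    rcases hor with h | h <;> simp [iQ_eq_ite, h]
  · by_cases hQy' : Conn ends (flipOn (splitAt ends b S) y) a₂ a₁
    · unfold covB; simp [iQ_eq_ite, hQy']
    by_cases hQw' : Conn ends (flipOn (splitAt ends b S) (flipOn S y)) a₂ a₁
    · unfold covB; simp [iQ_eq_ite, hQw']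
    exfalso
    -- both flipped copies have `Q`: transfer back gives `Q` in `y` and `w`
    have hy'_agree : ∀ e, e ∉ S → flipOn (splitAt ends b S) y e = z e := agree_flip_splitAt y hy
    have hflip : flipOn S (flipOn (splitAt ends b S) y) =
        flipOn (splitAt ends b S) (flipOn S y) := flipOn_splitAt_comm ends b S y
    obtain ⟨hc, -, -⟩ := transfer hd h1 h2 (flipOn (splitAt ends b S) y) hy'_agree hQy'
      (by rw [hflip]; exact hQw')
    rw [flipOn_self] at hc
    obtain ⟨hc', -, -⟩ := transfer hd h1 h2 (flipOn (splitAt ends b S) (flipOn S y))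
      (agree_flip_splitAt _ (agree_flip y hy)) hQw'
      (by rw [← hflip, flipOn_self]; exact hQy')
    rw [flipOn_self] at hc'
    rcases hor with h | h
    · exact hQy' ((hc a₂ a₁ h2 h1).1 h)
    · exact hQw' ((hc' a₂ a₁ h2 h1).1 h)

/-- **The b-transfer rule**: on a fibre whose split edges at `b` all lead to root-attached vertices
(and with no forced-open edge at `b`), the complementary-pair count of the split covariance of any
`b`-blind `X` against the side of `b` vanishes. -/
theorem pinnedCount_transfer_eq_zero {S : Finset E} {z : Config E}
    (hd : TransferData ends a₁ a₂ b S z) (h1 : a₁ ≠ b) (h2 : a₂ ≠ b) {X : Config E → R}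
    (hX : BBlind ends b X) :
    pinnedCount S z (covB ends a₁ a₂ b X) = 0 := by
  by_cases hSb : splitAt ends b S = ∅
  · -- no split edge at `b`: `b` is isolated in both copies and the side difference vanishes
    unfold pinnedCount
    refine Finset.sum_eq_zero fun y _ => ?_
    split_ifs with hy
    · have hiso : ∀ ω : Config E, (∀ e, e ∉ S → ω e = z e) → ∀ v, v ≠ b → ¬ Conn ends ω b v := by
        intro ω hω v hv h
        obtain ⟨e, he, u, hends, -⟩ := conn_b_imp ends ω hv h
        have hb : b ∈ ends e := by rw [hends]; exact Sym2.mem_mk_left b u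
        by_cases hS : e ∈ S
        · have : e ∈ splitAt ends b S := (mem_splitAt ends b).2 ⟨hS, hb⟩
          rw [hSb] at this
          exact absurd this (Finset.notMem_empty e)
        · rw [hω e hS, hd.zb e hb] at he
          exact Bool.false_ne_true he
      have hw : ∀ e, e ∉ S → flipOn S y e = z e := agree_flip y hy
      unfold covB
      rw [sigma_eq_ite, sigma_eq_ite]
      have n1 := hiso y hy a₁ h1
      have n2 := hiso y hy a₂ h2
      have n3 := hiso _ hw a₁ h1
      have n4 := hiso _ hw a₂ h2
      rw [if_neg (fun h => n1 (conn_symm h)), if_neg (fun h => n2 (conn_symm h)),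
        if_neg (fun h => n3 (conn_symm h)), if_neg (fun h => n4 (conn_symm h))]
      ring
    · rfl
  · obtain ⟨e₀, he₀⟩ := Finset.nonempty_iff_ne_empty.2 hSb
    unfold pinnedCount
    refine Finset.sum_involution (fun y _ => flipOn (splitAt ends b S) y) ?_ ?_ ?_ ?_
    · intro y _
      by_cases hy : ∀ e, e ∉ S → y e = z e
      · have hy' : ∀ e, e ∉ S → flipOn (splitAt ends b S) y e = z e := agree_flip_splitAt y hy
        rw [if_pos hy, if_pos hy', flipOn_splitAt_comm]
        by_cases hQ : ¬ Conn ends y a₂ a₁ ∧ ¬ Conn ends (flipOn S y) a₂ a₁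
        · rw [covB_flip_of_Q hd h1 h2 hX y hy hQ.1 hQ.2]; ring
        · obtain ⟨z1, z2⟩ := covB_eq_zero_of_not_Q hd h1 h2 X y hy hQ
          rw [z1, z2]; ring
      · have hy' : ¬ ∀ e, e ∉ S → flipOn (splitAt ends b S) y e = z e := by
          intro h
          apply hy
          intro e he
          rw [← h e he, flipOn_of_notMem _ _ (fun h' => he (splitAt_subset ends b S h'))]
        rw [if_neg hy, if_neg hy']; ring
    · intro y _ _ h
      have := congrFun h e₀
      rw [flipOn_of_mem _ _ he₀] at this
      exact Bool.not_ne_self (y e₀) this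
    · intro y _; exact Finset.mem_univ _
    · intro y _; exact flipOn_self _ y

/-- The two instances of the typed equality locus: `X = σ_o − σ₃ 1_{o∈U}` (piece 1 of the
symmetrised form) and `X = σ₃` (piece 2), for marks `o, a₁, a₂, a₃ ≠ b`. -/
theorem pinnedCount_transfer_F {o a₃ : V} {S : Finset E} {z : Config E}
    (hd : TransferData ends a₁ a₂ b S z) (h1 : a₁ ≠ b) (h2 : a₂ ≠ b) (ho : o ≠ b) (h3 : a₃ ≠ b) :
    pinnedCount S z (covB ends a₁ a₂ b (fun ω => sigma ends a₁ a₂ o ω -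
      sigma ends a₁ a₂ a₃ ω * inU ends a₁ a₂ o ω : Config E → R)) = 0 :=
  pinnedCount_transfer_eq_zero hd h1 h2 (bblind_sub ends b (bblind_sigma ends b h1 h2 ho)
    (bblind_mul ends b (bblind_sigma ends b h1 h2 h3) (bblind_inU ends b h1 h2 ho)))

/-- Piece 2 of the symmetrised form: `X = σ₃`, for `a₃ ≠ b`. -/
theorem pinnedCount_transfer_sigma3 {a₃ : V} {S : Finset E} {z : Config E}
    (hd : TransferData ends a₁ a₂ b S z) (h1 : a₁ ≠ b) (h2 : a₂ ≠ b) (h3 : a₃ ≠ b) :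
    pinnedCount S z (covB ends a₁ a₂ b (sigma ends a₁ a₂ a₃ : Config E → R)) = 0 :=
  pinnedCount_transfer_eq_zero hd h1 h2 (bblind_sigma ends b h1 h2 h3)

end Main

end FibreTransfer

end CovForm

end Summit.Ventures.PercRepro2
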